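import Summits.CriticalPhenomena.PercolationContinuityZ3.Theorems.PercNearOneGluingNoHeavyLowerTailSahiDeepCoreClassLaw
import Mathlib.Tactic.Linarith
import Mathlib.Tactic.Ring
import HarnessLib

/-!
# `NoHeavyLowerTail` (crux stmt-CriticalPhenomena-4575), master-family line P1: the STRONG CUBIC functional of the co-sunflower class,
# its exact one-coordinate bracket, and the reduction "∃ good coordinate ⟹ class law"

Support file (seat `prim-masterthm-p1`, gen 10; `--supports stmt-CriticalPhenomena-4575`).  Three definitions (`strongCubic`, `egcBracket`,
`ExistsGoodCoordinateS3`), no `sorry`, standard axioms.  Memo `run/shared/lean/prim/prim-masterthm/FROM-prim-masterthm-p1-g10-DEEP-CORE.md` §0, §4.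

SETTING.  A sandwiched triple `(A, B, N)` (`A ∖ B ⊆ N`, `B ∖ A ⊆ N`, `N ⊆ A ∪ B`; = co-sunflower `(G₂∪G₃, G₁∪G₃, G₁∪G₂)`; = Gladkov's 3-cell
partition) has the five cells `A∖B`, `B∖A`, `K = A∩B∩N`, `Dₙ = (A∩B)∖N`, `O = (A∪B)ᶜ` with masses `α, β, κ, d, o` (`α+β+κ+d+o = 1`,
`cells_sum_eq_one`).  The class functional is `E₃ = (1+o)(κo − αβ − αd − βd) − αβd` (`sahiE_three_eq_cells`); Gladkov's theorem is
`κo ≥ αβ + αd + βd`.  The STRONG CUBIC functional is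

  `F_S(A,B,N) := κ·o − (αβ + αd + βd) − αβd`      (`strongCubic`;  CONJECTURE S₃ of the memo: `F_S ≥ 0`, census-clean, OPEN),

and `E₃ ≥ F_S` (`sahiE_three_ge_strongCubic`, by Gladkov), so `F_S ≥ 0 ⟹` the class law.
ONE COORDINATE.  With `X⁰, X¹` the `e`-sections and `ΔX = μX¹ − μX⁰` (five cells), the EXACT identity (`strongCubic_eq_chord_add_bracket`)

  `F_S = (1 − p_e)·F_S(sections⁰) + p_e·F_S(sections¹) + p_e(1 − p_e)·β_e`,
  `β_e = Δκ·(−Δo) + (ΔαΔβ + ΔαΔd + ΔβΔd) + (ΔαΔβ·d⁰ + ΔαΔd·β⁰ + ΔβΔd·α⁰) + (1 + p_e)·ΔαΔβΔd`   (`egcBracket`)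

(the first two terms are Gladkov's nonnegative gain; the `d`-terms are the cubic correction).  Hence (`strongCubic_nonneg_of_EGC`,
`classLaw_of_EGC`): **if every sandwiched increasing triple determined by a nonempty coordinate set `S` has a coordinate `e ∈ S` with
`β_e ≥ 0` (`ExistsGoodCoordinateS3`, adversarially census-clean on ≤ 6 coordinates, memo §0), then `F_S ≥ 0` and Sahi's `C_3` holds on the whole
co-sunflower class** (induction on `S`; the sections of a sandwiched increasing triple are sandwiched increasing triples determined by `S ∖ {e}`).
HONEST FRAMING: a typed conjecture and a kernel-checked reduction; `ExistsGoodCoordinateS3`, S₃ and the class law remain OPEN. [this work]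
-/

noncomputable section

open scoped Classical

namespace Summit.CriticalPhenomena.PercolationContinuityZ3.Theorems

namespace SahiDeepCore

open Finset Function
open Literature.Combinatorics.Sahi2008
open Literature.Probability.Percolation (DeterminedBy determinedBy_iff)
open Literature.Probability.Percolation.DecisionTree (ind ind_of_mem ind_of_not_mem ind_nonneg)

variable {ι : Type} [Fintype ι]

local notation3 (prettyPrint := false) "m⟦" p ", " X "⟧" => ex (bernoulliWeight p) (ind X)

/-! ### 1. The strong cubic functional and its cells -/

/-- **The strong cubic functional** of a sandwiched triple: `κ·o − (αβ + αd + βd) − αβd` in the five cell masses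
`α = μ(A∖B)`, `β = μ(B∖A)`, `κ = μ(A∩B∩N)`, `d = μ((A∩B)∖N)`, `o = μ((A∪B)ᶜ)`.  Conjecturally nonnegative (S₃). [this work] -/
def strongCubic (p : ι → unitInterval) (A B N : Set (Set ι)) : ℝ :=
  m⟦p, A ∩ B ∩ N⟧ * m⟦p, (A ∪ B)ᶜ⟧
    - (m⟦p, A \ B⟧ * m⟦p, B \ A⟧ + m⟦p, A \ B⟧ * m⟦p, (A ∩ B) \ N⟧ + m⟦p, B \ A⟧ * m⟦p, (A ∩ B) \ N⟧)
    - m⟦p, A \ B⟧ * m⟦p, B \ A⟧ * m⟦p, (A ∩ B) \ N⟧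

omit [Fintype ι] in
/-- The five cells partition the cube (pointwise). [this work] -/
theorem ind_cells_sum (A B N : Set (Set ι)) :
    ind (A \ B) + ind (B \ A) + ind (A ∩ B ∩ N) + ind ((A ∩ B) \ N) + ind (A ∪ B)ᶜ = fun _ => (1 : ℝ) := by
  funext ω
  simp only [Pi.add_apply]
  by_cases ha : ω ∈ A <;> by_cases hb : ω ∈ B
  · rw [ind_of_not_mem (show ω ∉ A \ B from fun h => h.2 hb), ind_of_not_mem (show ω ∉ B \ A from fun h => h.2 ha),
      ind_of_not_mem (show ω ∉ (A ∪ B)ᶜ from fun h => h (Or.inl ha))]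
    by_cases hn : ω ∈ N
    · rw [ind_of_mem (show ω ∈ A ∩ B ∩ N from ⟨⟨ha, hb⟩, hn⟩), ind_of_not_mem (show ω ∉ (A ∩ B) \ N from fun h => h.2 hn)]; norm_num
    · rw [ind_of_not_mem (show ω ∉ A ∩ B ∩ N from fun h => hn h.2), ind_of_mem (show ω ∈ (A ∩ B) \ N from ⟨⟨ha, hb⟩, hn⟩)]; norm_num
  · rw [ind_of_mem (show ω ∈ A \ B from ⟨ha, hb⟩), ind_of_not_mem (show ω ∉ B \ A from fun h => hb h.1),
      ind_of_not_mem (show ω ∉ A ∩ B ∩ N from fun h => hb h.1.2), ind_of_not_mem (show ω ∉ (A ∩ B) \ N from fun h => hb h.1.2),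
      ind_of_not_mem (show ω ∉ (A ∪ B)ᶜ from fun h => h (Or.inl ha))]; norm_num
  · rw [ind_of_not_mem (show ω ∉ A \ B from fun h => ha h.1), ind_of_mem (show ω ∈ B \ A from ⟨hb, ha⟩),
      ind_of_not_mem (show ω ∉ A ∩ B ∩ N from fun h => ha h.1.1), ind_of_not_mem (show ω ∉ (A ∩ B) \ N from fun h => ha h.1.1),
      ind_of_not_mem (show ω ∉ (A ∪ B)ᶜ from fun h => h (Or.inr hb))]; norm_num
  · rw [ind_of_not_mem (show ω ∉ A \ B from fun h => ha h.1), ind_of_not_mem (show ω ∉ B \ A from fun h => hb h.1),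
      ind_of_not_mem (show ω ∉ A ∩ B ∩ N from fun h => ha h.1.1), ind_of_not_mem (show ω ∉ (A ∩ B) \ N from fun h => ha h.1.1),
      ind_of_mem (show ω ∈ (A ∪ B)ᶜ from fun h => h.elim ha hb)]; norm_num

/-- **The five cell masses sum to one.** [this work] -/
theorem cells_sum_eq_one (p : ι → unitInterval) (A B N : Set (Set ι)) :
    m⟦p, A \ B⟧ + m⟦p, B \ A⟧ + m⟦p, A ∩ B ∩ N⟧ + m⟦p, (A ∩ B) \ N⟧ + m⟦p, (A ∪ B)ᶜ⟧ = 1 := by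
  have h := congrArg (ex (bernoulliWeight p)) (ind_cells_sum A B N)
  rw [ex_add, ex_add, ex_add, ex_add, ex_const (sum_bernoulliWeight p)] at h
  exact h

/-- Cell bookkeeping: `μA = α + κ + d`, `μB = β + κ + d`, `μ(A∩B) = κ + d` for a sandwiched triple. [this work] -/
theorem cells_of_sandwich (p : ι → unitInterval) {A B N : Set (Set ι)} (hAB : A \ B ⊆ N) (hN : N ⊆ A ∪ B) :
    m⟦p, A⟧ = m⟦p, A \ B⟧ + m⟦p, A ∩ B ∩ N⟧ + m⟦p, (A ∩ B) \ N⟧ ∧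
      m⟦p, A ∩ B⟧ = m⟦p, A ∩ B ∩ N⟧ + m⟦p, (A ∩ B) \ N⟧ := by
  have h1 := congrArg (ex (bernoulliWeight p)) (ind_sandwich_first hAB hN)
  have h2 := congrArg (ex (bernoulliWeight p)) (ind_inter_split A B N)
  rw [ex_add, ex_add] at h1
  rw [ex_add] at h2
  have h3 : m⟦p, A ∩ N⟧ = m⟦p, A \ B⟧ + m⟦p, A ∩ B ∩ N⟧ := by
    have e : ind (A ∩ N) = ind (A \ B) + ind (A ∩ B ∩ N) := by
      funext ω
      simp only [Pi.add_apply]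
      by_cases ha : ω ∈ A
      · by_cases hb : ω ∈ B
        · rw [ind_of_not_mem (show ω ∉ A \ B from fun h => h.2 hb)]
          by_cases hn : ω ∈ N
          · rw [ind_of_mem (show ω ∈ A ∩ N from ⟨ha, hn⟩), ind_of_mem (show ω ∈ A ∩ B ∩ N from ⟨⟨ha, hb⟩, hn⟩)]; norm_num
          · rw [ind_of_not_mem (show ω ∉ A ∩ N from fun h => hn h.2), ind_of_not_mem (show ω ∉ A ∩ B ∩ N from fun h => hn h.2)]; norm_num
        · rw [ind_of_mem (show ω ∈ A \ B from ⟨ha, hb⟩), ind_of_mem (show ω ∈ A ∩ N from ⟨ha, hAB ⟨ha, hb⟩⟩),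
            ind_of_not_mem (show ω ∉ A ∩ B ∩ N from fun h => hb h.1.2)]; norm_num
      · rw [ind_of_not_mem (show ω ∉ A ∩ N from fun h => ha h.1), ind_of_not_mem (show ω ∉ A \ B from fun h => ha h.1),
          ind_of_not_mem (show ω ∉ A ∩ B ∩ N from fun h => ha h.1.1)]; norm_num
    have h := congrArg (ex (bernoulliWeight p)) e
    rwa [ex_add] at h
  constructor <;> linarith

/-- **`E₃` in the five cells**: `E₃(A,B,N) = (1 + o)(κo − αβ − αd − βd) − αβd` for every sandwiched triple. [this work] -/
theorem sahiE_three_eq_cells (p : ι → unitInterval) {A B N : Set (Set ι)} (hAB : A \ B ⊆ N) (hBA : B \ A ⊆ N) (hN : N ⊆ A ∪ B) :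
    sahiE (bernoulliWeight p) 3 ![ind A, ind B, ind N] =
      (1 + m⟦p, (A ∪ B)ᶜ⟧) * (m⟦p, A ∩ B ∩ N⟧ * m⟦p, (A ∪ B)ᶜ⟧
          - (m⟦p, A \ B⟧ * m⟦p, B \ A⟧ + m⟦p, A \ B⟧ * m⟦p, (A ∩ B) \ N⟧ + m⟦p, B \ A⟧ * m⟦p, (A ∩ B) \ N⟧))
        - m⟦p, A \ B⟧ * m⟦p, B \ A⟧ * m⟦p, (A ∩ B) \ N⟧ := by
  rw [sahiE_three_sandwich_eq (bernoulliWeight p) hAB hBA hN]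
  obtain ⟨hA, hT⟩ := cells_of_sandwich p hAB hN
  have hN' : N ⊆ B ∪ A := fun ω h => (hN h).symm
  obtain ⟨hB, hT'⟩ := cells_of_sandwich p hBA hN'
  rw [Set.inter_comm B A] at hB hT'
  have hsum := cells_sum_eq_one p A B N
  have ho : m⟦p, (A ∪ B)ᶜ⟧ = 1 - (m⟦p, A \ B⟧ + m⟦p, B \ A⟧ + m⟦p, A ∩ B ∩ N⟧ + m⟦p, (A ∩ B) \ N⟧) := by linarith
  rw [hA, hB, hT, ho]
  ring

/-- **`E₃ ≥ F_S`** (the difference is `o·(κo − e₂) ≥ 0` by Gladkov / deep-core Harris). [this work] -/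
theorem sahiE_three_ge_strongCubic (p : ι → unitInterval) {A B N : Set (Set ι)} (hA : IsUpperSet A) (hB : IsUpperSet B) (hNup : IsUpperSet N)
    (hAB : A \ B ⊆ N) (hBA : B \ A ⊆ N) (hN : N ⊆ A ∪ B) :
    strongCubic p A B N ≤ sahiE (bernoulliWeight p) 3 ![ind A, ind B, ind N] := by
  rw [sahiE_three_eq_cells p hAB hBA hN, strongCubic]
  -- Gladkov in cells: κ o ≥ αβ + αd + βd, from `inter_diff_harris` rewritten
  have hG := inter_diff_harris p hA hB hNup hAB hBA
  obtain ⟨hAe, hT⟩ := cells_of_sandwich p hAB hN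
  have hN' : N ⊆ B ∪ A := fun ω h => (hN h).symm
  obtain ⟨hBe, hT'⟩ := cells_of_sandwich p hBA hN'
  rw [Set.inter_comm B A] at hBe hT'
  have hsum := cells_sum_eq_one p A B N
  rw [hAe, hBe, hT] at hG
  have ho : 0 ≤ m⟦p, (A ∪ B)ᶜ⟧ := ex_nonneg (isFKGMeasure_bernoulliWeight p).nonneg fun ω => ind_nonneg _ ω
  have ho' : m⟦p, (A ∪ B)ᶜ⟧ = 1 - (m⟦p, A \ B⟧ + m⟦p, B \ A⟧ + m⟦p, A ∩ B ∩ N⟧ + m⟦p, (A ∩ B) \ N⟧) := by linarith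
  have key : m⟦p, A ∩ B ∩ N⟧ * (1 - (m⟦p, A \ B⟧ + m⟦p, B \ A⟧ + m⟦p, A ∩ B ∩ N⟧ + m⟦p, (A ∩ B) \ N⟧))
      - (m⟦p, A \ B⟧ * m⟦p, B \ A⟧ + m⟦p, A \ B⟧ * m⟦p, (A ∩ B) \ N⟧ + m⟦p, B \ A⟧ * m⟦p, (A ∩ B) \ N⟧)
      = (m⟦p, A ∩ B ∩ N⟧ + m⟦p, (A ∩ B) \ N⟧
          - (m⟦p, A \ B⟧ + m⟦p, A ∩ B ∩ N⟧ + m⟦p, (A ∩ B) \ N⟧) * (m⟦p, B \ A⟧ + m⟦p, A ∩ B ∩ N⟧ + m⟦p, (A ∩ B) \ N⟧))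
        - m⟦p, (A ∩ B) \ N⟧ * (1 - (m⟦p, A ∩ B ∩ N⟧ + m⟦p, (A ∩ B) \ N⟧)) := by ring
  have hglad : 0 ≤ m⟦p, A ∩ B ∩ N⟧ * m⟦p, (A ∪ B)ᶜ⟧
      - (m⟦p, A \ B⟧ * m⟦p, B \ A⟧ + m⟦p, A \ B⟧ * m⟦p, (A ∩ B) \ N⟧ + m⟦p, B \ A⟧ * m⟦p, (A ∩ B) \ N⟧) := by
    rw [ho', key]; linarith
  nlinarith [mul_nonneg ho hglad]

/-! ### 2. Sections and the exact one-coordinate bracket -/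

omit [Fintype ι] in
/-- Sections commute with the cell operations. [folklore] -/
theorem secAt_cells (e : ι) (b : Bool) (A B N : Set (Set ι)) :
    secAt e b (A \ B) = secAt e b A \ secAt e b B ∧ secAt e b (A ∩ B ∩ N) = secAt e b A ∩ secAt e b B ∩ secAt e b N ∧
      secAt e b ((A ∩ B) \ N) = (secAt e b A ∩ secAt e b B) \ secAt e b N ∧ secAt e b (A ∪ B)ᶜ = (secAt e b A ∪ secAt e b B)ᶜ := by
  cases b <;> exact ⟨rfl, rfl, rfl, rfl⟩

/-- **The one-coordinate bracket `β_e`** of the strong cubic functional (memo §0): with `X⁰, X¹` the `e`-sections of the five cells and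
`ΔX = μX¹ − μX⁰`:  `Δκ·(μO⁰ − μO¹) + e₂(Δα, Δβ, Δd) + (ΔαΔβ·d⁰ + ΔαΔd·β⁰ + ΔβΔd·α⁰) + (1 + p_e)·ΔαΔβΔd`. [this work] -/
def egcBracket (p : ι → unitInterval) (e : ι) (A B N : Set (Set ι)) : ℝ :=
  (m⟦p, secAt e true (A ∩ B ∩ N)⟧ - m⟦p, secAt e false (A ∩ B ∩ N)⟧) * (m⟦p, secAt e false (A ∪ B)ᶜ⟧ - m⟦p, secAt e true (A ∪ B)ᶜ⟧)
  + ((m⟦p, secAt e true (A \ B)⟧ - m⟦p, secAt e false (A \ B)⟧) * (m⟦p, secAt e true (B \ A)⟧ - m⟦p, secAt e false (B \ A)⟧)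
     + (m⟦p, secAt e true (A \ B)⟧ - m⟦p, secAt e false (A \ B)⟧) * (m⟦p, secAt e true ((A ∩ B) \ N)⟧ - m⟦p, secAt e false ((A ∩ B) \ N)⟧)
     + (m⟦p, secAt e true (B \ A)⟧ - m⟦p, secAt e false (B \ A)⟧) * (m⟦p, secAt e true ((A ∩ B) \ N)⟧ - m⟦p, secAt e false ((A ∩ B) \ N)⟧))
  + ((m⟦p, secAt e true (A \ B)⟧ - m⟦p, secAt e false (A \ B)⟧) * (m⟦p, secAt e true (B \ A)⟧ - m⟦p, secAt e false (B \ A)⟧)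
       * m⟦p, secAt e false ((A ∩ B) \ N)⟧
     + (m⟦p, secAt e true (A \ B)⟧ - m⟦p, secAt e false (A \ B)⟧) * (m⟦p, secAt e true ((A ∩ B) \ N)⟧ - m⟦p, secAt e false ((A ∩ B) \ N)⟧)
       * m⟦p, secAt e false (B \ A)⟧
     + (m⟦p, secAt e true (B \ A)⟧ - m⟦p, secAt e false (B \ A)⟧) * (m⟦p, secAt e true ((A ∩ B) \ N)⟧ - m⟦p, secAt e false ((A ∩ B) \ N)⟧)
       * m⟦p, secAt e false (A \ B)⟧)
  + (1 + (p e : ℝ)) * ((m⟦p, secAt e true (A \ B)⟧ - m⟦p, secAt e false (A \ B)⟧) * (m⟦p, secAt e true (B \ A)⟧ - m⟦p, secAt e false (B \ A)⟧)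
       * (m⟦p, secAt e true ((A ∩ B) \ N)⟧ - m⟦p, secAt e false ((A ∩ B) \ N)⟧))

/-- The chord/bracket identity as pure algebra. [this work] -/
theorem chord_bracket_identity (q k0 k1 o0 o1 a0 a1 b0 b1 d0 d1 : ℝ) :
    (q * k1 + (1 - q) * k0) * (q * o1 + (1 - q) * o0)
      - ((q * a1 + (1 - q) * a0) * (q * b1 + (1 - q) * b0) + (q * a1 + (1 - q) * a0) * (q * d1 + (1 - q) * d0)
          + (q * b1 + (1 - q) * b0) * (q * d1 + (1 - q) * d0))
      - (q * a1 + (1 - q) * a0) * (q * b1 + (1 - q) * b0) * (q * d1 + (1 - q) * d0)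
    = (1 - q) * (k0 * o0 - (a0 * b0 + a0 * d0 + b0 * d0) - a0 * b0 * d0)
      + q * (k1 * o1 - (a1 * b1 + a1 * d1 + b1 * d1) - a1 * b1 * d1)
      + q * (1 - q) * ((k1 - k0) * (o0 - o1) + ((a1 - a0) * (b1 - b0) + (a1 - a0) * (d1 - d0) + (b1 - b0) * (d1 - d0))
          + ((a1 - a0) * (b1 - b0) * d0 + (a1 - a0) * (d1 - d0) * b0 + (b1 - b0) * (d1 - d0) * a0)
          + (1 + q) * ((a1 - a0) * (b1 - b0) * (d1 - d0))) := by
  ring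

/-- **THE ONE-COORDINATE IDENTITY for the strong cubic functional**:
`F_S(A,B,N) = (1 − p_e)·F_S(A⁰,B⁰,N⁰) + p_e·F_S(A¹,B¹,N¹) + p_e(1 − p_e)·β_e`. [this work] -/
theorem strongCubic_eq_chord_add_bracket (p : ι → unitInterval) (e : ι) (A B N : Set (Set ι)) :
    strongCubic p A B N =
      (1 - (p e : ℝ)) * strongCubic p (secAt e false A) (secAt e false B) (secAt e false N)
        + (p e : ℝ) * strongCubic p (secAt e true A) (secAt e true B) (secAt e true N)
        + (p e : ℝ) * (1 - (p e : ℝ)) * egcBracket p e A B N := by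
  obtain ⟨f1, f2, f3, f4⟩ := secAt_cells e false A B N
  obtain ⟨t1, t2, t3, t4⟩ := secAt_cells e true A B N
  have fb : secAt e false (B \ A) = secAt e false B \ secAt e false A := (secAt_cells e false B A N).1
  have tb : secAt e true (B \ A) = secAt e true B \ secAt e true A := (secAt_cells e true B A N).1
  simp only [strongCubic, egcBracket]
  rw [← f1, ← f2, ← f3, ← f4, ← t1, ← t2, ← t3, ← t4, ← fb, ← tb]
  rw [ex_ind_eq_secAt p e (A ∩ B ∩ N), ex_ind_eq_secAt p e (A ∪ B)ᶜ, ex_ind_eq_secAt p e (A \ B), ex_ind_eq_secAt p e (B \ A),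
    ex_ind_eq_secAt p e ((A ∩ B) \ N)]
  exact chord_bracket_identity (p e : ℝ) _ _ _ _ _ _ _ _ _ _

/-! ### 3. The reduction: ∃ good coordinate ⟹ S₃ ⟹ class law -/

/-- **CONJECTURE EGC-S₃ (typed): every sandwiched increasing triple determined by a nonempty coordinate set has a GOOD coordinate**
(one with `β_e ≥ 0`) in that set.  Adversarially census-clean on ≤ 6 coordinates (memo §0; kit j163406–11); all coordinate-averaged
versions are false.  Vacuity check: for constant events all `β_e = 0`; on an empty index type there is no nonempty `S`. [this work] [status: open] -/
@[conjecture] def ExistsGoodCoordinateS3 (p : ι → unitInterval) : Prop :=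
  ∀ (S : Finset ι) (A B N : Set (Set ι)), S.Nonempty → IsUpperSet A → IsUpperSet B → IsUpperSet N →
    A \ B ⊆ N → B \ A ⊆ N → N ⊆ A ∪ B →
    DeterminedBy A (↑S : Set ι) → DeterminedBy B (↑S : Set ι) → DeterminedBy N (↑S : Set ι) →
    ∃ e ∈ S, 0 ≤ egcBracket p e A B N

/-- `μ_p(∅) = 0`. [folklore] -/
private theorem m_empty (p : ι → unitInterval) : m⟦p, (∅ : Set (Set ι))⟧ = 0 := by
  have h0 : ind (∅ : Set (Set ι)) = fun _ => 0 := funext fun ω => ind_of_not_mem (Set.notMem_empty ω)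
  rw [h0, ex_def]; simp

/-- On events determined by no coordinate the strong cubic functional is nonnegative (indeed zero): every cell is `∅` or `univ`,
the five masses are `0/1` and sum to one. [this work] -/
theorem strongCubic_of_determinedBy_empty (p : ι → unitInterval) {A B N : Set (Set ι)}
    (hAd : DeterminedBy A (↑(∅ : Finset ι) : Set ι)) (hBd : DeterminedBy B (↑(∅ : Finset ι) : Set ι))
    (hNd : DeterminedBy N (↑(∅ : Finset ι) : Set ι)) : 0 ≤ strongCubic p A B N := by
  have cst : ∀ X : Set (Set ι), DeterminedBy X (↑(∅ : Finset ι) : Set ι) → ∀ ω ω' : Set ι, (ω ∈ X ↔ ω' ∈ X) :=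
    fun X hX ω ω' => ((determinedBy_iff X _).1 hX) ω ω' (by simp)
  have cA := cst A hAd; have cB := cst B hBd; have cN := cst N hNd
  have mk : ∀ X : Set (Set ι), (∀ ω ω' : Set ι, (ω ∈ X ↔ ω' ∈ X)) → (m⟦p, X⟧ = 0 ∨ m⟦p, X⟧ = 1) := by
    intro X hX
    have hXd : DeterminedBy X (↑(∅ : Finset ι) : Set ι) := (determinedBy_iff X _).2 fun ω ω' _ => hX ω ω'
    rcases eq_empty_or_univ_of_determinedBy_empty hXd with rfl | rfl
    · exact Or.inl (m_empty p)
    · right; rw [ind_univ_eq_one]; exact ex_one (sum_bernoulliWeight p)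
  have h1 := mk (A \ B) fun ω ω' => by rw [Set.mem_sdiff, Set.mem_sdiff, cA ω ω', cB ω ω']
  have h2 := mk (B \ A) fun ω ω' => by rw [Set.mem_sdiff, Set.mem_sdiff, cA ω ω', cB ω ω']
  have h3 := mk (A ∩ B ∩ N) fun ω ω' => by simp only [Set.mem_inter_iff]; rw [cA ω ω', cB ω ω', cN ω ω']
  have h4 := mk ((A ∩ B) \ N) fun ω ω' => by simp only [Set.mem_sdiff, Set.mem_inter_iff]; rw [cA ω ω', cB ω ω', cN ω ω']
  have h5 := mk (A ∪ B)ᶜ fun ω ω' => by simp only [Set.mem_compl_iff, Set.mem_union]; rw [cA ω ω', cB ω ω']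
  have hsum := cells_sum_eq_one p A B N
  simp only [strongCubic]
  rcases h1 with h1 | h1 <;> rcases h2 with h2 | h2 <;> rcases h3 with h3 | h3 <;> rcases h4 with h4 | h4 <;> rcases h5 with h5 | h5 <;>
    · rw [h1, h2, h3, h4, h5] at hsum ⊢; linarith

/-- **THEOREM (the reduction, on a determining set): EGC-S₃ ⟹ `F_S ≥ 0`** for every sandwiched increasing triple determined by `S`
(induction on `S`, the step being `strongCubic_eq_chord_add_bracket` at the good coordinate). [this work] -/
theorem strongCubic_nonneg_of_EGC (p : ι → unitInterval) (hEGC : ExistsGoodCoordinateS3 p) (S : Finset ι) :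
    ∀ (A B N : Set (Set ι)), IsUpperSet A → IsUpperSet B → IsUpperSet N → A \ B ⊆ N → B \ A ⊆ N → N ⊆ A ∪ B →
      DeterminedBy A (↑S : Set ι) → DeterminedBy B (↑S : Set ι) → DeterminedBy N (↑S : Set ι) → 0 ≤ strongCubic p A B N := by
  induction S using Finset.strongInduction with
  | H S ih =>
    intro A B N hA hB hN hAB hBA hNs hAd hBd hNd
    by_cases hS : S.Nonempty
    · obtain ⟨e, heS, hgood⟩ := hEGC S A B N hS hA hB hN hAB hBA hNs hAd hBd hNd
      have hsub : S.erase e ⊂ S := Finset.erase_ssubset heS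
      -- sections: increasing, sandwiched, determined by `S.erase e`
      have hsec : ∀ (b : Bool), 0 ≤ strongCubic p (secAt e b A) (secAt e b B) (secAt e b N) := by
        intro b
        obtain ⟨f1, -, -, -⟩ := secAt_cells e b A B N
        have fb : secAt e b (B \ A) = secAt e b B \ secAt e b A := (secAt_cells e b B A N).1
        refine ih (S.erase e) hsub _ _ _ (isUpperSet_secAt e b hA) (isUpperSet_secAt e b hB) (isUpperSet_secAt e b hN) ?_ ?_ ?_
          (determinedBy_secAt e b hAd) (determinedBy_secAt e b hBd) (determinedBy_secAt e b hNd)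
        · rw [← f1]; intro ω hω; rw [mem_secAt] at hω ⊢; exact hAB hω
        · rw [← fb]; intro ω hω; rw [mem_secAt] at hω ⊢; exact hBA hω
        · intro ω hω
          rw [mem_secAt] at hω
          rcases hNs hω with h | h
          · exact Or.inl (mem_secAt.2 h)
          · exact Or.inr (mem_secAt.2 h)
      rw [strongCubic_eq_chord_add_bracket p e A B N]
      have hpe0 : 0 ≤ (p e : ℝ) := (p e).2.1
      have hpe1 : (p e : ℝ) ≤ 1 := (p e).2.2
      have h0 := hsec false
      have h1 := hsec true
      have h2 : 0 ≤ (p e : ℝ) * (1 - (p e : ℝ)) * egcBracket p e A B N :=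
        mul_nonneg (mul_nonneg hpe0 (sub_nonneg.2 hpe1)) hgood
      nlinarith [mul_nonneg (sub_nonneg.2 hpe1) h0, mul_nonneg hpe0 h1]
    · rw [Finset.not_nonempty_iff_eq_empty] at hS
      subst hS
      exact strongCubic_of_determinedBy_empty p hAd hBd hNd

/-- **THEOREM: EGC-S₃ ⟹ the strong cubic inequality S₃** (`κo ≥ e₂ + e₃` in cells) on every finite cube. [this work] -/
theorem strongCubic_nonneg_of_EGC' (p : ι → unitInterval) (hEGC : ExistsGoodCoordinateS3 p) {A B N : Set (Set ι)}
    (hA : IsUpperSet A) (hB : IsUpperSet B) (hN : IsUpperSet N) (hAB : A \ B ⊆ N) (hBA : B \ A ⊆ N) (hNs : N ⊆ A ∪ B) :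
    0 ≤ strongCubic p A B N :=
  strongCubic_nonneg_of_EGC p hEGC Finset.univ A B N hA hB hN hAB hBA hNs (determinedBy_coe_univ A) (determinedBy_coe_univ B)
    (determinedBy_coe_univ N)

/-- **THEOREM (EGC-S₃ ⟹ the co-sunflower class law).**  If every sandwiched increasing triple has a good coordinate, then Sahi's `C_3`
holds for every sandwiched increasing triple, in particular for every `(G₂∪G₃, G₁∪G₃, G₁∪G₂)` with `G_i` increasing. [this work] -/
theorem classLaw_of_EGC (p : ι → unitInterval) (hEGC : ExistsGoodCoordinateS3 p) {A B N : Set (Set ι)}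
    (hA : IsUpperSet A) (hB : IsUpperSet B) (hN : IsUpperSet N) (hAB : A \ B ⊆ N) (hBA : B \ A ⊆ N) (hNs : N ⊆ A ∪ B) :
    0 ≤ sahiE (bernoulliWeight p) 3 ![ind A, ind B, ind N] :=
  le_trans (strongCubic_nonneg_of_EGC' p hEGC hA hB hN hAB hBA hNs) (sahiE_three_ge_strongCubic p hA hB hN hAB hBA hNs)

/-- The co-sunflower form of `classLaw_of_EGC`. [this work] -/
theorem coSunflower_nonneg_of_EGC (p : ι → unitInterval) (hEGC : ExistsGoodCoordinateS3 p) {G₁ G₂ G₃ : Set (Set ι)}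
    (h₁ : IsUpperSet G₁) (h₂ : IsUpperSet G₂) (h₃ : IsUpperSet G₃) :
    0 ≤ sahiE (bernoulliWeight p) 3 ![ind (G₂ ∪ G₃), ind (G₁ ∪ G₃), ind (G₁ ∪ G₂)] := by
  obtain ⟨s1, s2, s3⟩ := coSunflower_sandwich G₁ G₂ G₃
  exact classLaw_of_EGC p hEGC (h₂.union h₃) (h₁.union h₃) (h₁.union h₂) s1 s2 s3

end SahiDeepCore

end Summit.CriticalPhenomena.PercolationContinuityZ3.Theorems
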